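import Summits.QuantumFields.YangMills.Theorems.LuscherReductionRunningReductionCoarseUpperScalesTwo
import Summits.QuantumFields.YangMills.Theorems.FemtoTransferGapSlabGround
import HarnessLib

/-!
# The COVARIANT weighted Schur door for the VALLEY: `ValleyGainAt` from a row bound of the full transfer kernel on the valley set
# (lane A of S-BASE, crux `TwistedTraceScaling` stmt-QuantumFields-20203 / KT-door 3b′ of RED stmt-QuantumFields-19978; design note
# `pub/ym-fleet/ym-luscher-20007-p1/COARSE-DESIGN.md` §13–§14)

The VALLEY target `ValleyGainAt L δ η` (`…CoarseUpperDefs`) asks, for every `A` and eventually in `β`, `⟨φ, K_β φ⟩ ≤ e^{−Aλ_b(L³β)} λ₀ ‖φ‖²` for every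
physical `φ` supported in the valley set `{S(U) < 2η(β)} ∩ {∀ z, δ(β)/2 < orbitDist(τ_z U)}`.  The axial door `valleyGainAt_of_rowBound` (`…ValleyAxial`)
derives it from a row bound for the AXIAL kernel on `SU(2)^{off}`.  Lane B's Gaussian machinery (`Cov.transferApply_stiffTrial_le`, `…PointwiseSuper`)
produces row bounds for the FULL kernel `K_β` on `GaugeConfig 3 L SU2` — `(K_β H)(U) = transferApply β H U ≤ Λ(U)·H(U)` — with NO gauge fixing.  This
file is the matching door, so that the valley can be closed in the covariant currency directly:

* `qform_le_of_kernelRow` — the weighted Schur test on a measurable region `R ⊆ GaugeConfig 3 L SU2` for the symmetric kernel `K_β`: a measurable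
  weight `h`, bounded, with `h ≥ c > 0` on `R`, and the row bound `∫_R K_β(U,V) h(V) dV ≤ Λ h(U)` for `U ∈ R` give `⟨φ,K_βφ⟩ ≤ Λ‖φ‖²` for every bounded
  measurable `φ` supported in `R` (no invariance of `φ` or `h` is needed; AM–GM `φ(U)φ(V) ≤ ½(φ(U)²h(V)/h(U) + φ(V)²h(U)/h(V))` and `K_β(U,V) = K_β(V,U)`);
* `qform_le_of_transferApply_le` — the same with the row bound stated for lane B's `transferApply β h` (all of `V`-space; valid when `h ≥ 0`);
* `valleySet L δ η` — the valley set of `ValleyGainAt` as a named measurable set; `ValleyKernelRowBoundAt L δ η` — **C3 in covariant form**: for every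
  `A`, eventually in `β`, SOME measurable weight `h ≥ 0`, `c ≤ h ≤ C` on the valley set (`c > 0`), has `transferApply β (𝟙_valley·h) U ≤ e^{−Aλ_b(L³β)} λ₀ h(U)`
  on the valley set; ★ `valleyGainAt_of_kernelRowBound : ValleyKernelRowBoundAt L δ η → ValleyGainAt L δ η`, and the variant
  `valleyGainAt_of_transferApplyBound` with the un-truncated `transferApply β h`.

So a C3 prover working with lane B's covariant super-solution bounds owes exactly ONE weight `h` per `(A, β)` and ONE pointwise inequality on the valley
set; with `coarseNoIntruderAt_of_valley_oneOrbit_pow₂` (`…CoarseUpperScalesTwo`) the scales may be `(δ, η) = (β^{−p}, β^{−q})`, `0 < p < 1/3`, `q < 1/3`.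
HONEST FRAMING: measure-theoretic bookkeeping (Schur test); the row bound itself (C3) is OPEN; femto rung R2b1 of the CONDITIONAL reduction route;
not infinite volume, not a gap, not Clay.
-/

set_option autoImplicit false

noncomputable section

open MeasureTheory Filter Topology Real
open scoped BigOperators
open Literature.MathematicalPhysics.QuantumFieldTheory
open Literature.MathematicalPhysics.QuantumLattice

namespace Summit.QuantumFields.YangMills.Theorems.FemtoTransferGap

variable {L : ℕ} [NeZero L]

/-! ## §1 The weighted Schur test for the full kernel on a region -/

/-- **Weighted Schur test for `K_β` on a region.**  Let `R` be measurable, `φ` bounded measurable and supported in `R`, `h` bounded measurable with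
`h ≥ c > 0` on `R`, and suppose the row bound `∫ 𝟙_R(V) K_β(U,V) h(V) dV ≤ Λ·h(U)` at every `U ∈ R`.  Then `⟨φ, K_β φ⟩ ≤ Λ ‖φ‖²` (`β ≥ 0`).
[cite: Grafakos2009, App. A.2, Lemma ((iii) ⇒ (i), p = 2)] -/
theorem qform_le_of_kernelRow {β : ℝ} (hβ : 0 ≤ β) {φ : GaugeConfig 3 L SU2 → ℝ} (hφm : Measurable φ) {Cφ : ℝ} (hφb : ∀ U, |φ U| ≤ Cφ)
    {R : Set (GaugeConfig 3 L SU2)} (hR : MeasurableSet R) (hsupp : ∀ U, φ U ≠ 0 → U ∈ R)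
    {h : GaugeConfig 3 L SU2 → ℝ} (hhm : Measurable h) {c C : ℝ} (hc : 0 < c) (hch : ∀ U ∈ R, c ≤ h U) (hhC : ∀ U, |h U| ≤ C)
    {Λ : ℝ} (hrow : ∀ U ∈ R, ∫ V, R.indicator (fun V => transferKernel su2Rep β U V * h V) V ∂configMeasure SU2 L ≤ Λ * h U) :
    qform su2Rep β φ φ ≤ Λ * l2 φ φ := by
  classical
  set μ : Measure (GaugeConfig 3 L SU2) := configMeasure SU2 L with hμ
  set K : GaugeConfig 3 L SU2 → GaugeConfig 3 L SU2 → ℝ := fun U V => transferKernel su2Rep β U V with hK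
  have hKpos : ∀ U V, 0 < K U V := fun U V => transferKernel_pos _ _ _ _
  have hKsymm : ∀ U V, K U V = K V U := fun U V => transferKernel_su2Rep_symm β U V
  have hKm : Measurable fun p : GaugeConfig 3 L SU2 × GaugeConfig 3 L SU2 => K p.1 p.2 := measurable_transferKernel_lat β
  have hKb : ∀ p : GaugeConfig 3 L SU2 × GaugeConfig 3 L SU2, |K p.1 p.2| ≤ Real.exp (2 * β) ^ Fintype.card (Edge 3 L) :=
    abs_transferKernel_le_lat hβ
  have hhpos : ∀ U ∈ R, 0 < h U := fun U hU => lt_of_lt_of_le hc (hch U hU)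
  have hCφ : 0 ≤ Cφ := (abs_nonneg _).trans (hφb 1)
  have hC0 : 0 ≤ C := (abs_nonneg _).trans (hhC 1)
  have hφ0 : ∀ U, U ∉ R → φ U = 0 := fun U hU => by by_contra hne; exact hU (hsupp U hne)
  -- the two auxiliary functions
  set f₁ : GaugeConfig 3 L SU2 → ℝ := fun U => R.indicator h U with hf₁
  set f₂ : GaugeConfig 3 L SU2 → ℝ := fun U => R.indicator (fun U => φ U ^ 2 / h U) U with hf₂
  have hf₁m : Measurable f₁ := hhm.indicator hR
  have hf₂m : Measurable f₂ := ((hφm.pow_const 2).div hhm).indicator hR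
  have hf₁b : ∀ U, |f₁ U| ≤ C := fun U => by
    rw [hf₁]; dsimp only
    by_cases hU : U ∈ R
    · rw [Set.indicator_of_mem hU]; exact hhC U
    · rw [Set.indicator_of_notMem hU, abs_zero]; exact hC0
  have hf₂b : ∀ U, |f₂ U| ≤ Cφ ^ 2 / c := fun U => by
    rw [hf₂]; dsimp only
    by_cases hU : U ∈ R
    · rw [Set.indicator_of_mem hU, abs_div, abs_of_pos (hhpos U hU), abs_pow]
      exact div_le_div₀ (by positivity) (pow_le_pow_left₀ (abs_nonneg _) (hφb U) 2) hc (hch U hU)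
    · rw [Set.indicator_of_notMem hU, abs_zero]; positivity
  have hf₁0 : ∀ U, 0 ≤ f₁ U := fun U => by
    rw [hf₁]; dsimp only
    by_cases hU : U ∈ R
    · rw [Set.indicator_of_mem hU]; exact (hhpos U hU).le
    · rw [Set.indicator_of_notMem hU]
  have hf₂0 : ∀ U, 0 ≤ f₂ U := fun U => by
    rw [hf₂]; dsimp only
    by_cases hU : U ∈ R
    · rw [Set.indicator_of_mem hU]; exact div_nonneg (sq_nonneg _) (hhpos U hU).le
    · rw [Set.indicator_of_notMem hU]
  -- pointwise AM–GM: `φ(U) K φ(V) ≤ ½ (f₂(U)·K·f₁(V) + f₁(U)·K·f₂(V))`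
  have hptw : ∀ p : GaugeConfig 3 L SU2 × GaugeConfig 3 L SU2, φ p.1 * K p.1 p.2 * φ p.2 ≤
      (1 / 2) * (f₂ p.1 * K p.1 p.2 * f₁ p.2) + (1 / 2) * (f₁ p.1 * K p.1 p.2 * f₂ p.2) := by
    rintro ⟨U, V⟩
    dsimp only
    have hKUV := (hKpos U V).le
    by_cases hU : U ∈ R
    · by_cases hV : V ∈ R
      · rw [hf₁, hf₂]; dsimp only
        rw [Set.indicator_of_mem hU, Set.indicator_of_mem hV, Set.indicator_of_mem hU, Set.indicator_of_mem hV]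
        have h1 := hhpos U hU
        have h2 := hhpos V hV
        have key : 2 * (φ U * φ V) ≤ φ U ^ 2 / h U * h V + h U * (φ V ^ 2 / h V) := by
          have e : φ U ^ 2 / h U * h V + h U * (φ V ^ 2 / h V) - 2 * (φ U * φ V) = (φ U * h V - φ V * h U) ^ 2 / (h U * h V) := by
            field_simp
            ring
          have : 0 ≤ (φ U * h V - φ V * h U) ^ 2 / (h U * h V) := div_nonneg (sq_nonneg _) (mul_pos h1 h2).le
          linarith
        nlinarith [mul_le_mul_of_nonneg_left key hKUV]
      · rw [hφ0 V hV, mul_zero]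
        exact add_nonneg (mul_nonneg (by norm_num) (mul_nonneg (mul_nonneg (hf₂0 U) hKUV) (hf₁0 V)))
          (mul_nonneg (by norm_num) (mul_nonneg (mul_nonneg (hf₁0 U) hKUV) (hf₂0 V)))
    · rw [hφ0 U hU, zero_mul, zero_mul]
      exact add_nonneg (mul_nonneg (by norm_num) (mul_nonneg (mul_nonneg (hf₂0 U) hKUV) (hf₁0 V)))
        (mul_nonneg (by norm_num) (mul_nonneg (mul_nonneg (hf₁0 U) hKUV) (hf₂0 V)))
  -- integrability
  have hIφ := integrable_latSandwich hKm hKb hφm hφm hφb hφb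
  have hI21 := integrable_latSandwich hKm hKb hf₂m hf₁m hf₂b hf₁b
  have hI12 := integrable_latSandwich hKm hKb hf₁m hf₂m hf₁b hf₂b
  -- the main term `T = ∫∫ f₂(U) K(U,V) f₁(V)` is at most `Λ ∫ φ²`
  have hrowU : ∀ U, ∫ V, f₂ U * K U V * f₁ V ∂μ ≤ Λ * (φ U * φ U) := by
    intro U
    have e1 : ∫ V, f₂ U * K U V * f₁ V ∂μ = f₂ U * ∫ V, R.indicator (fun V => transferKernel su2Rep β U V * h V) V ∂μ := by
      rw [← integral_const_mul]
      refine integral_congr_ae (ae_of_all _ fun V => ?_)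
      dsimp only
      rw [hf₁]; dsimp only
      rw [mul_assoc]
      congr 1
      exact (Set.indicator_mul_right R (fun V => transferKernel su2Rep β U V) h).symm
    rw [e1]
    by_cases hU : U ∈ R
    · have hf₂U : f₂ U = φ U ^ 2 / h U := by rw [hf₂]; dsimp only; rw [Set.indicator_of_mem hU]
      calc f₂ U * ∫ V, R.indicator (fun V => transferKernel su2Rep β U V * h V) V ∂μ ≤ f₂ U * (Λ * h U) :=
            mul_le_mul_of_nonneg_left (hrow U hU) (hf₂0 U)
        _ = Λ * (φ U * φ U) := by rw [hf₂U, mul_comm Λ (h U), ← mul_assoc, div_mul_cancel₀ _ (hhpos U hU).ne', pow_two, mul_comm]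
    · have hf₂U : f₂ U = 0 := by rw [hf₂]; dsimp only; rw [Set.indicator_of_notMem hU]
      rw [hf₂U, zero_mul, hφ0 U hU, mul_zero, mul_zero]
  have hT : ∫ p, f₂ p.1 * K p.1 p.2 * f₁ p.2 ∂μ.prod μ ≤ Λ * l2 φ φ := by
    rw [integral_prod _ hI21]
    have hIl : Integrable (fun U => Λ * (φ U * φ U)) μ := by
      refine (integrable_of_measurable_abs_le _ (f := fun U => φ U * φ U) (hφm.mul hφm) (C := Cφ * Cφ) fun U => ?_).const_mul Λ
      rw [abs_mul]; exact mul_le_mul (hφb U) (hφb U) (abs_nonneg _) hCφ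
    calc ∫ U, ∫ V, f₂ U * K U V * f₁ V ∂μ ∂μ ≤ ∫ U, Λ * (φ U * φ U) ∂μ := integral_mono hI21.integral_prod_left hIl hrowU
      _ = Λ * l2 φ φ := by rw [integral_const_mul]; rfl
  -- the mirror term equals `T` by the symmetry of the kernel
  have hT' : ∫ p, f₁ p.1 * K p.1 p.2 * f₂ p.2 ∂μ.prod μ = ∫ p, f₂ p.1 * K p.1 p.2 * f₁ p.2 ∂μ.prod μ := by
    have e := integral_prod_swap (μ := μ) (ν := μ) (fun p : GaugeConfig 3 L SU2 × GaugeConfig 3 L SU2 => f₂ p.1 * K p.1 p.2 * f₁ p.2)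
    simp only [Prod.fst_swap, Prod.snd_swap] at e
    rw [← e]
    refine integral_congr_ae (ae_of_all _ fun p => ?_)
    dsimp only
    rw [hKsymm p.2 p.1]; ring
  -- assemble
  have hq : qform su2Rep β φ φ = ∫ p, φ p.1 * K p.1 p.2 * φ p.2 ∂μ.prod μ := (integral_prod _ hIφ).symm
  rw [hq]
  calc ∫ p, φ p.1 * K p.1 p.2 * φ p.2 ∂μ.prod μ
      ≤ ∫ p, (1 / 2) * (f₂ p.1 * K p.1 p.2 * f₁ p.2) + (1 / 2) * (f₁ p.1 * K p.1 p.2 * f₂ p.2) ∂μ.prod μ :=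
        integral_mono hIφ ((hI21.const_mul _).add (hI12.const_mul _)) hptw
    _ = (1 / 2) * ∫ p, f₂ p.1 * K p.1 p.2 * f₁ p.2 ∂μ.prod μ + (1 / 2) * ∫ p, f₁ p.1 * K p.1 p.2 * f₂ p.2 ∂μ.prod μ := by
        rw [integral_add (hI21.const_mul _) (hI12.const_mul _), integral_const_mul, integral_const_mul]
    _ ≤ Λ * l2 φ φ := by rw [hT']; linarith [hT]

/-- The truncated row is below the full row when the weight is non-negative: `∫ 𝟙_R K_β(U,·) h ≤ (K_β h)(U) = transferApply β h U`. [folklore] -/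
theorem integral_indicator_kernel_le_transferApply {β : ℝ} {R : Set (GaugeConfig 3 L SU2)} (hR : MeasurableSet R)
    {h : GaugeConfig 3 L SU2 → ℝ} (hhm : Measurable h) (hh0 : ∀ V, 0 ≤ h V) {C : ℝ} (hhC : ∀ V, |h V| ≤ C) (U : GaugeConfig 3 L SU2) :
    ∫ V, R.indicator (fun V => transferKernel su2Rep β U V * h V) V ∂configMeasure SU2 L ≤ transferApply β h U := by
  unfold transferApply
  have hI : Integrable (fun V => transferKernel su2Rep β U V * h V) (configMeasure SU2 L) := integrable_transferKernel_mul β U hhm hhC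
  refine integral_mono (hI.indicator hR) hI fun V => ?_
  by_cases hV : V ∈ R
  · simp only [Set.indicator_of_mem hV, le_refl]
  · simp only [Set.indicator_of_notMem hV]
    exact mul_nonneg (transferKernel_pos _ _ _ _).le (hh0 V)

/-- **Weighted Schur test for `K_β` on a region, `transferApply` form.**  As `qform_le_of_kernelRow`, with a weight `h ≥ 0` everywhere and the row bound
stated for the un-truncated transfer `(K_β h)(U) = transferApply β h U ≤ Λ h(U)` on `R`. [cite: Grafakos2009, App. A.2, Lemma ((iii) ⇒ (i), p = 2)] -/
theorem qform_le_of_transferApply_le {β : ℝ} (hβ : 0 ≤ β) {φ : GaugeConfig 3 L SU2 → ℝ} (hφm : Measurable φ) {Cφ : ℝ} (hφb : ∀ U, |φ U| ≤ Cφ)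
    {R : Set (GaugeConfig 3 L SU2)} (hR : MeasurableSet R) (hsupp : ∀ U, φ U ≠ 0 → U ∈ R)
    {h : GaugeConfig 3 L SU2 → ℝ} (hhm : Measurable h) (hh0 : ∀ U, 0 ≤ h U) {c C : ℝ} (hc : 0 < c) (hch : ∀ U ∈ R, c ≤ h U) (hhC : ∀ U, |h U| ≤ C)
    {Λ : ℝ} (hrow : ∀ U ∈ R, transferApply β h U ≤ Λ * h U) :
    qform su2Rep β φ φ ≤ Λ * l2 φ φ :=
  qform_le_of_kernelRow hβ hφm hφb hR hsupp hhm hc hch hhC fun U hU =>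
    (integral_indicator_kernel_le_transferApply hR hhm hh0 hhC U).trans (hrow U hU)

/-! ## §2 The valley set and the covariant C3 door -/

variable (L) in
/-- **The valley set** at scales `(δ, η)`: small action `S(U) < 2η` and every centre-twisted copy `τ_z U` at orbit distance `> δ/2` from the pure gauges —
exactly the support condition of `ValleyGainAt L δ η`. [folklore] -/
def valleySet (δ η : ℝ) : Set (GaugeConfig 3 L SU2) :=
  {U | wilsonAction su2Rep U < 2 * η ∧ ∀ z : Fin 3 → Bool, δ / 2 < orbitDist (TT.twist3 z U)}

/-- Membership in the valley set, unfolded. [folklore] -/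
theorem mem_valleySet_iff {δ η : ℝ} {U : GaugeConfig 3 L SU2} :
    U ∈ valleySet L δ η ↔ wilsonAction su2Rep U < 2 * η ∧ ∀ z : Fin 3 → Bool, δ / 2 < orbitDist (TT.twist3 z U) := Iff.rfl

/-- The valley set is measurable. [folklore] -/
theorem measurableSet_valleySet (δ η : ℝ) : MeasurableSet (valleySet L δ η) := by
  haveI : SecondCountableTopology SU2 := secondCountableTopology_su2
  have hS : Measurable fun U : GaugeConfig 3 L SU2 => wilsonAction su2Rep U := (continuous_wilsonAction su2Rep continuous_su2Rep).measurable
  have h : valleySet L δ η = {U | wilsonAction su2Rep U < 2 * η} ∩ ⋂ z : Fin 3 → Bool, {U | δ / 2 < orbitDist (TT.twist3 z U)} := by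
    ext U; simp [valleySet]
  rw [h]
  exact (measurableSet_lt hS measurable_const).inter
    (MeasurableSet.iInter fun z => measurableSet_lt measurable_const (measurable_orbitDist_twist3 z))

/-- In axial coordinates the valley set is the valley region: `glue w ∈ valleySet ↔ w ∈ valleyRegion`. [folklore] -/
theorem glue_mem_valleySet_iff (δ η : ℝ) (w : OffIdx L → SU2) : glue w ∈ valleySet L δ η ↔ w ∈ valleyRegion (L := L) δ η := Iff.rfl

variable (L) in
/-- **C3 in covariant form — VALLEY KERNEL ROW BOUND at scales `(δ, η)`** (OPEN, L/XL): for every `A`, eventually in `β`, there is a measurable weight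
`h ≥ 0` on `GaugeConfig 3 L SU2`, bounded, with `h ≥ c > 0` on the valley set, such that the transfer kernel truncated to the valley set satisfies the ROW
super-solution bound `∫_{valley} K_β(U,V) h(V) dV ≤ e^{−A·λ_b(L³β)}·λ₀(β,L)·h(U)` at every `U` of the valley set.  Target text of this programme
(the weight is the Born–Oppenheimer ansatz: one-site valley weight of the constant modes × fattened covariant stiff Gaussian; Lüscher 1983 §3), not a
published theorem. -/
def ValleyKernelRowBoundAt (δ η : ℝ → ℝ) : Prop :=
  ∀ A : ℝ, ∃ β0 : ℝ, ∀ β : ℝ, β0 ≤ β →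
    ∃ (h : GaugeConfig 3 L SU2 → ℝ) (c C : ℝ), Measurable h ∧ 0 < c ∧ (∀ U, 0 ≤ h U) ∧ (∀ U ∈ valleySet L (δ β) (η β), c ≤ h U) ∧ (∀ U, h U ≤ C) ∧
      ∀ U ∈ valleySet L (δ β) (η β),
        ∫ V, (valleySet L (δ β) (η β)).indicator (fun V => transferKernel su2Rep β U V * h V) V ∂configMeasure SU2 L
          ≤ Real.exp (-(A * bareLambda ((L : ℝ) ^ 3 * β))) * levelValue su2Rep L β 0 * h U

/-- ★★ **VALLEY GAIN from a covariant valley row bound**: `ValleyKernelRowBoundAt L δ η → ValleyGainAt L δ η`. [cite: Grafakos2009, App. A.2] -/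
theorem valleyGainAt_of_kernelRowBound {δ η : ℝ → ℝ} (hV : ValleyKernelRowBoundAt L δ η) : ValleyGainAt L δ η := by
  intro A
  obtain ⟨β0, hβ0⟩ := hV A
  refine ⟨max β0 0, fun β hβ φ hφ hsupp => ?_⟩
  have hβ' : β0 ≤ β := (le_max_left _ _).trans hβ
  have hβ0' : 0 ≤ β := (le_max_right _ _).trans hβ
  obtain ⟨h, c, C, hhm, hc, hh0, hch, hhC, hrow⟩ := hβ0 β hβ'
  obtain ⟨Cφ, hCφ⟩ := hφ.bounded
  have hsupp' : ∀ U, φ U ≠ 0 → U ∈ valleySet L (δ β) (η β) := fun U hU => hsupp U hU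
  have hhC' : ∀ U, |h U| ≤ C := fun U => by rw [abs_of_nonneg (hh0 U)]; exact hhC U
  have := qform_le_of_kernelRow hβ0' hφ.measurable hCφ (measurableSet_valleySet (δ β) (η β)) hsupp' hhm hc hch hhC'
    (Λ := Real.exp (-(A * bareLambda ((L : ℝ) ^ 3 * β))) * levelValue su2Rep L β 0) (fun U hU => hrow U hU)
  linarith [this]

/-- ★★ **VALLEY GAIN from an un-truncated transfer bound on the valley set** (lane B's `transferApply` currency): if for every `A`, eventually in `β`, some
measurable `h ≥ 0`, bounded, with `h ≥ c > 0` on the valley set, has `(K_β h)(U) ≤ e^{−Aλ_b(L³β)} λ₀ h(U)` at every valley point, then `ValleyGainAt L δ η`.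
[cite: Grafakos2009, App. A.2] -/
theorem valleyGainAt_of_transferApplyBound {δ η : ℝ → ℝ}
    (hV : ∀ A : ℝ, ∃ β0 : ℝ, ∀ β : ℝ, β0 ≤ β →
      ∃ (h : GaugeConfig 3 L SU2 → ℝ) (c C : ℝ), Measurable h ∧ 0 < c ∧ (∀ U, 0 ≤ h U) ∧ (∀ U ∈ valleySet L (δ β) (η β), c ≤ h U) ∧ (∀ U, h U ≤ C) ∧
        ∀ U ∈ valleySet L (δ β) (η β), transferApply β h U ≤ Real.exp (-(A * bareLambda ((L : ℝ) ^ 3 * β))) * levelValue su2Rep L β 0 * h U) :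
    ValleyGainAt L δ η := by
  refine valleyGainAt_of_kernelRowBound fun A => ?_
  obtain ⟨β0, hβ0⟩ := hV A
  refine ⟨β0, fun β hβ => ?_⟩
  obtain ⟨h, c, C, hhm, hc, hh0, hch, hhC, hrow⟩ := hβ0 β hβ
  have hhC' : ∀ U, |h U| ≤ C := fun U => by rw [abs_of_nonneg (hh0 U)]; exact hhC U
  exact ⟨h, c, C, hhm, hc, hh0, hch, hhC, fun U hU =>
    (integral_indicator_kernel_le_transferApply (measurableSet_valleySet (δ β) (η β)) hhm hh0 hhC' U).trans (hrow U hU)⟩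

/-- ★★★ **COARSE-UPPER(L) from the covariant VALLEY KERNEL ROW BOUND and INNER NO-INTRUDER (one orbit) at two polynomial scales**
`(δ, η) = (β^{−p}, β^{−q})`, `0 < p < 1/3`, `q < 1/3` (conclusion = VERBATIM the body of KTR's `CoarseNoIntruderAt L`; `L = 2` is stub 3b′).
[cite: Luscher1983, §3] [cite: LuscherMunster1984, §2] -/
theorem coarseNoIntruderAt_of_kernelRow_pow₂ {p q : ℝ} (hp0 : 0 < p) (hp : p < 1 / 3) (hq : q < 1 / 3)
    (hV : ValleyKernelRowBoundAt L (powScale p) (powScale q)) (hI : InnerNoIntruderOneOrbitAt L (powScale p)) :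
    ∀ k : ℕ, ∀ d : ℝ, d < levelGap k → ∃ lam0 : ℝ, 0 < lam0 ∧ ∀ lam : ℝ, 0 < lam → lam ≤ lam0 →
      ∀ β : ℝ, InFemtoWindow lam β L →
        levelValue su2Rep L β k ≤ Real.exp (-(d * luscherLambda β L) / L) * levelValue su2Rep L β 0 :=
  coarseNoIntruderAt_of_valley_oneOrbit_pow₂ hp0 hp hq (valleyGainAt_of_kernelRowBound hV) hI

end Summit.QuantumFields.YangMills.Theorems.FemtoTransferGap

end
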